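/-
Copyright: b2b-lace cell (CriticalPhenomena). Text-final: lean1-g51 desk draft 2 (9d165bb95c53e798; = lean1-g50 desk draft 1
12fc1dcd9a9d9362 + the tf-time swap list) + header relabel, filed by lean1-g51 under REFEREE v219 R1416 (T2 booking; ORDERS
v222 (b)) after T1 `NobleWeightedDiagSplit` (c11638786dac7132), T3-RIGHT `NobleWeightedDiagRight` and T3-LEFT
`NobleWeightedDiagLeft` landed; off-diagonal right leaves: split of weight, letter transport, product bounds `𝓣 ≤ 𝓣*`;
no numeral; d-generic; no cited hypothesis.
-/
import Literature.Probability.FitznerVanDerHofstad2017.NobleWeightedDiagRight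
import Literature.Probability.FitznerVanDerHofstad2017.NobleWeightedDiagLeft
import Literature.Probability.FitznerVanDerHofstad2017.NobleWeightedLettersHn
import Literature.Probability.FitznerVanDerHofstad2017.UnitVectorPairSums
import HarnessLib

/-!
# [FvdH17] App. C.1, Cases c)–d): the OFF-DIAGONAL half `x ≠ w` of the right-trivial pieces of `Ξ^{(1),ι}_α − Ξ^{(0),ι}_α`

CITATION HEADER (PLACEMENT v2). This module is part of a certified REPRODUCTION of:
R. Fitzner, R. van der Hofstad, *Mean-field behavior for nearest-neighbor percolation in `d > 10`*, Electron. J.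
Probab. **22** (2017) no. 43 [FvdH17] (arXiv:1506.07977v2): App. C.1 "Improvement of differences: Split of weight",
Cases c) and d), displays (C.4)–(C.5) (pp. 79–80); App. B, Tables "definition of `P^b`", "definition of `A^{ι,a,b}`",
display "double-open triangle `Ā^{ι,a,b}`" (pp. 73–78); §5.2 (Hi-defs) (p. 50); §4.2 Def. 4.1, (4.1), (4.8),
(4.14)–(4.17) (pp. 34–36); §3.5 "Symmetry of the model" (p. 32).  Origin: build `lace` (host summit CriticalPhenomena),
LEAN TYPING SEAT 1; node N76, leaf T2 (off-diagonal leaves, right side).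

WHAT THIS FILE DOES.  `NobleWeightedDiagSplit` splits each right-trivial piece `rawRPiece Sn Ab ι a` (`a = 1, 2`) of
the weighted `N = 1` coefficient into the DIAGONAL addend `rawRDiag` (exit point `x = w`, middle displacement `0`) and
the OFF-DIAGONAL addend `rawROffDiag` (`x ≠ w`).  This file treats ONLY the off-diagonal addend, for the start
letter `P^{S,a}` (`blockPSn`) and the middle table `Ā'^{ι,a,0}` (`blockAbar'`):
* §A (every `Sn`, `Ab`): the off-diagonal addend is the right piece of the MASKED middle family
  `maskDiagR Ab := (1−δ_{t,w})·Ab` (`rawROffDiag_eq_rawRPieceOff0_maskDiagR`), and the weight `‖x‖₂²` splits along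
  `0 → w → x` (`rawRPieceOff0_le_two_split`: `‖x‖₂² ≤ 2‖w‖₂² + 2‖x−w‖₂²`, the "split of weight" of App. C.1).
* §B (percolation): OFF the diagonal the middle letter's third line `{x ←(≥0)→ w}` joins DISTINCT points, so it IS a
  line of length `≥ 1`: `{x ←0→ w} = {x ←1→ w}` for `x ≠ w` ((4.1): a path between distinct points has at least one
  step) — `perc_T_geZero_eq_geOne_of_ne`; hence rows `(2,0)` and `(1,0)` of `Ā'` read, off the diagonal, as the
  three-line letter `𝓣_{1̲,1,1}(e_ι, x−u, w−u)` of (C.4)–(C.5) (`perc_maskDiagR_blockAbar'_two_zero`, `…_one_zero`).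
* §C (percolation): the `‖x−w‖₂²`-weighted middle letter, summed over `ι` and `x`, IS the second member
  `Σ_{e,y} ‖y‖₂² 𝓣_{1,1,1̲}(y, s−e, s)` of `H₂(s)` at `s = u − w` (translation by `w`, lines read backwards):
  `perc_sum_tsum_wt_offMid_eq_letterHT₁`.
* §D (percolation, class `a = 2`, Case d)): `Σ_ι rawROffDiag (blockPSn 𝐋) (blockAbar' 𝐋) ι 2 ≤ 2·W₂ + 2·X₂` with the
  START LETTERS KEPT — `X₂ = Σ_{u,w} (1−δ_{u,0})(1−δ_{w,0}) 𝓣_{1,2,1}(u,w,0) · (H₂-member)(u−w)` (an identity) and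
  `W₂ = Σ_s M(s) · WTT(s)` (an identity; `M(s) := Σ_{ι,x} 𝓣_{1̲,1,1}(e_ι,x,s)`, `WTT` of `NobleWeightedDiagRight`) —
  `perc_sum_rawROffDiag_two_le_letters`; then the PRODUCT corollaries (`𝓣 ≤ 𝓣*`, (4.8), (4.14)–(4.17), on the start
  letter only): `W₂ ≤ Σ_s τ₂(s)·M(s)·Φ(s)` (`Φ = wtOpenBubbleAt`), `X₂ ≤ sup_{s≠0} H₂(s) · Σ_{u,w} 𝓣_{1,2,1}(u,w,0)` —
  the second term of (C.5) verbatim — `perc_sum_rawROffDiag_two_le`, `perc_sum_rawROffDiag_two_le_sup`.  Print's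
  first term of (C.5), `sup_{x≠0} H₁(x) Σ_{ι,x,y} 𝓢_{1̲,1,1,2}(e_ι,x,y,0)`, REGROUPS the start line `{u ←2→ w}` into the
  middle letter; those regrouped letters are not reached by the typed objects and are not asserted.
* §E (percolation, class `a = 1`, Case c)): the middle displacement `w − u` runs over the unit vectors (`2dD(w−u)`),
  the `W_d`-symmetry evaluates every direction at `e_{ι₀}`, and with the START LETTERS KEPT
  `Σ_ι rawROffDiag (blockPSn 𝐋) (blockAbar' 𝐋) ι 1 ≤ 2·2d·M(e_{ι₀})·WTB(e_{ι₀}) + 2·(H₂-member)(e_{ι₀})·2d·TT_{1̲}(e_{ι₀})`,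
  `TT_j(s) = Σ_w (1−δ_{w,0})(1−δ_{w−s,0}) 𝓣_{1,j,1}(w−s,w,0)` (the plain start letter summed off `0`; the same object as
  `diagLTT` of `NobleWeightedDiagLeft`) (`perc_sum_rawROffDiag_one_le_letters`; the middle loses only `(1−δ_{x,u}) ≤ 1`);
  PRODUCT corollary `… ≤ 2·2d·M(e_{ι₀})·p·Φ(e_{ι₀}) + 2·(H₂-member)(e_{ι₀})·2d·p·Φ⁰(e_{ι₀})` (`Φ⁰ = openBubbleAt` of
  `NobleWeightedDiagLeft`, the plain open bubble; `perc_sum_rawROffDiag_one_le`) — the two terms of (C.4), whose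
  `H₁(e₁)`-reading is a regrouped letter the typed product does not reach.
App. C.1 (C.4)∕(C.5) are cited ONLY as the source of the index pattern of the OFF-DIAGONAL bound (never of the split,
never of a diagonal bound); no docstring asserts an inequality between an App. C.1 letter and a row letter.
The left twins (`rawLOffDiag`, `P^{E,b}`) are the sibling module `NobleWeightedOffDiagLeft`.

DIAGONAL CONVENTION (GAPS G-D98).  Every statement here is about the off-diagonal addend `rawROffDiag` ALONE; the
diagonal addend `rawRDiag` (`x = w`: there the third index is `≥ 0`, the trivial line, and the letter is the
one-bond letter `K`) is carried separately (`NobleWeightedDiagRight`) and is NOT bounded by the letters of this file.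
App. C.1 is cited as the source of the OFF-DIAGONAL letters and bounds only.  No numeral; nothing landed is
modified; no cited hypothesis.
-/

noncomputable section

namespace Literature.Probability.FitznerVanDerHofstad2017

open scoped BigOperators ENNReal
open _root_.MeasureTheory
open Literature.Probability.LatticeModels Literature.Probability.Percolation
open Literature.Probability.FitznerVanDerHofstad2017.BlockSummation
open Literature.Probability.FitznerVanDerHofstad2017.NobleBlocks
open Literature.Probability.FitznerVanDerHofstad2017.NobleBlocks.LenIdx
open Literature.Probability.FitznerVanDerHofstad2017.UnitVectorPairs (opp opp_opp)

variable {d : ℕ}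

local notation "𝐞" => Literature.Probability.Percolation.stepVec

/-! ## A. The masked middle family, the off-diagonal addend, the split of weight (every `Sn`, `Ab`) -/

/-- **Diagonal mask of a middle block family**: `(maskDiagR Ab)^{ι,a,b}(u,w,t,z) := (1 − δ_{t,w}) Ab^{ι,a,b}(u,w,t,z)`
— the exit point `t` is kept OFF the second point `w` (middle displacement `w − t ≠ 0`).
(GAPS G-D98: the off-diagonal addend `rawROffDiag` only — the diagonal `x = w` is the separate addend `rawRDiag`,
carried and priced on its own, and is not bounded here.)
[cite: FitznerVanDerHofstad2017, §4.4 (4.65) (arXiv:1506.07977v2 p. 43); Lemma 5.1 second version (p. 50) — the off-diagonal addend `rawROffDiag` of the split of `NobleWeightedDiagSplit`] -/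
def maskDiagR (Ab : DirBlockFamily d) : DirBlockFamily d := fun ι a b u w t z => kdc t w * Ab ι a b u w t z

/-- The mask only removes mass.
(GAPS G-D98: the off-diagonal addend `rawROffDiag` only — the diagonal `x = w` is the separate addend `rawRDiag`,
carried and priced on its own, and is not bounded here.)
[cite: FitznerVanDerHofstad2017, §4.4 (4.65) (arXiv:1506.07977v2 p. 43); Lemma 5.1 second version (p. 50)] -/
theorem maskDiagR_le (Ab : DirBlockFamily d) (ι : Fin d × Bool) (a b : Fin 3) (u w t z : Site d) :
    maskDiagR Ab ι a b u w t z ≤ Ab ι a b u w t z := by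
  calc maskDiagR Ab ι a b u w t z = kdc t w * Ab ι a b u w t z := rfl
    _ ≤ 1 * Ab ι a b u w t z := mul_le_mul' (kdc_le_one _ _) le_rfl
    _ = _ := one_mul _

/-- On the diagonal `t = w` the masked family vanishes.
(GAPS G-D98: the off-diagonal addend `rawROffDiag` only — the diagonal `x = w` is the separate addend `rawRDiag`,
carried and priced on its own, and is not bounded here.)
[cite: FitznerVanDerHofstad2017, §4.4 (4.65) (arXiv:1506.07977v2 p. 43); Lemma 5.1 second version (p. 50)] -/
@[simp] theorem maskDiagR_apply_diag (Ab : DirBlockFamily d) (ι : Fin d × Bool) (a b : Fin 3) (u w z : Site d) :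
    maskDiagR Ab ι a b u w w z = 0 := by
  simp only [maskDiagR, kdc_self, zero_mul]

/-- Off the diagonal the masked family is the family.
(GAPS G-D98: the off-diagonal addend `rawROffDiag` only — the diagonal `x = w` is the separate addend `rawRDiag`,
carried and priced on its own, and is not bounded here.)
[cite: FitznerVanDerHofstad2017, §4.4 (4.65) (arXiv:1506.07977v2 p. 43); Lemma 5.1 second version (p. 50)] -/
theorem maskDiagR_of_ne (Ab : DirBlockFamily d) (ι : Fin d × Bool) (a b : Fin 3) (u : Site d) {w t : Site d}
    (z : Site d) (h : t ≠ w) : maskDiagR Ab ι a b u w t z = Ab ι a b u w t z := by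
  simp only [maskDiagR, kdc_of_ne h, one_mul]

/-- **The off-diagonal addend is the right-trivial piece of the masked family**:
`rawROffDiag Sn Ab ι a = rawRPieceOff0 Sn (maskDiagR Ab) ι a` (both are
`Σ_{x,u,w} ‖x‖₂² (1−δ_{x,w})(1−δ_{w,0}) Sn^a(u,w) Ab^{ι,a,0}(u,w,x,x)`).
(GAPS G-D98: the off-diagonal addend `rawROffDiag` only — the diagonal `x = w` is the separate addend `rawRDiag`,
carried and priced on its own, and is not bounded here.)
[cite: FitznerVanDerHofstad2017, §4.4 (4.65) (arXiv:1506.07977v2 p. 43); Lemma 5.1 second version (p. 50)] -/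
theorem rawROffDiag_eq_rawRPieceOff0_maskDiagR (Sn : Fin 3 → Site d → Site d → ℝ≥0∞) (Ab : DirBlockFamily d)
    (ι : Fin d × Bool) (a : Fin 3) : rawROffDiag Sn Ab ι a = rawRPieceOff0 Sn (maskDiagR Ab) ι a := by
  unfold rawROffDiag rawRPieceOff0
  refine tsum_congr fun x => tsum_congr fun u => tsum_congr fun w => ?_
  simp only [maskDiagR]
  ring

/-- **Split of weight along `0 → w → x`** for a right-trivial piece off `w = 0`:
`Σ ‖x‖₂² (…) ≤ 2 Σ ‖w‖₂² (…) + 2 Σ ‖x−w‖₂² (…)` (`‖x‖₂² ≤ 2‖w‖₂² + 2‖w−x‖₂²`).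
(Generic in every family `Sn`, `Ab`: letter-free kernel algebra, D98-neutral; applied in this file to the masked
family `maskDiagR (blockAbar' 𝐋)` only, i.e. to the off-diagonal addend `rawROffDiag` — GAPS G-D98.)
[cite: FitznerVanDerHofstad2017, Lemma 5.1 second version (arXiv:1506.07977v2 p. 50); App. C.1 "Split of weight", (C.1): the weight ALGEBRA `‖x‖₂² ≤ 2‖w‖₂² + 2‖x−w‖₂²` only (p. 79)] -/
theorem rawRPieceOff0_le_two_split (Sn : Fin 3 → Site d → Site d → ℝ≥0∞) (Ab : DirBlockFamily d)
    (ι : Fin d × Bool) (a : Fin 3) :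
    rawRPieceOff0 Sn Ab ι a ≤
      2 * (∑' x, ∑' u, ∑' w, wt w * (kdc w 0 * (Sn a u w * Ab ι a 0 u w x x))) +
        2 * (∑' x, ∑' u, ∑' w, wt (w - x) * (kdc w 0 * (Sn a u w * Ab ι a 0 u w x x))) := by
  unfold rawRPieceOff0
  calc ∑' x, ∑' u, ∑' w, wt x * (kdc w 0 * (Sn a u w * Ab ι a 0 u w x x))
      ≤ ∑' x, ∑' u, ∑' w, 2 * (wt w + wt (w - x)) * (kdc w 0 * (Sn a u w * Ab ι a 0 u w x x)) :=
        ENNReal.tsum_le_tsum fun x => ENNReal.tsum_le_tsum fun u => ENNReal.tsum_le_tsum fun w =>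
          mul_le_mul' (wt_le_two_split_left x w) le_rfl
    _ = _ := by
        simp only [mul_add, add_mul, mul_assoc, ENNReal.tsum_add, ENNReal.tsum_mul_left]

/-- Rearrangement: a factor depending on `(u,w)` only comes out of the sums over `ι` and `x`. [folklore] -/
private theorem sum_tsum₃_factor (S : Site d → Site d → ℝ≥0∞) (G : (Fin d × Bool) → Site d → Site d → Site d → ℝ≥0∞) :
    ∑ ι, ∑' x, ∑' u, ∑' w, S u w * G ι x u w = ∑' u, ∑' w, S u w * ∑ ι, ∑' x, G ι x u w := by
  have h1 : ∀ ι, ∑' x, ∑' u, ∑' w, S u w * G ι x u w = ∑' u, ∑' w, ∑' x, S u w * G ι x u w := by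
    intro ι
    rw [ENNReal.tsum_comm]
    exact tsum_congr fun u => ENNReal.tsum_comm
  simp_rw [h1]
  rw [← tsum_finsetSum]
  refine tsum_congr fun u => ?_
  rw [← tsum_finsetSum]
  refine tsum_congr fun w => ?_
  rw [Finset.mul_sum]
  refine Finset.sum_congr rfl fun ι _ => ?_
  rw [ENNReal.tsum_mul_left]

/-- **The plain off-diagonal middle sum** `M_L(s) := Σ_ι Σ_x 𝓣_{1̲,1,1}(e_ι, x, s)`: the pivotal bond `0 → e_ι`, a
line `e_ι → x`, a line `x → s` (the three-line letter of (C.4)–(C.5) at base point `0`, summed over the direction and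
the exit point).
(GAPS G-D98: the off-diagonal addend `rawROffDiag` only — the diagonal `x = w` is the separate addend `rawRDiag`,
carried and priced on its own, and is not bounded here.)
[cite: FitznerVanDerHofstad2017, App. C.1 (C.4)–(C.5), the letter `T_{1̲,1,1}(e_ι,x−u,w−u)` — index pattern of the off-diagonal bound (arXiv:1506.07977v2 pp. 79–80); §4.2 (4.17) (p. 36)] -/
def offMidSum (L : Letters d) (s : Site d) : ℝ≥0∞ :=
  ∑ ι : Fin d × Bool, ∑' x, L.T (.eq 1) (.ge 1) (.ge 1) (𝐞 ι) x s

/-- **`sup_{s ≠ 0} Φ_L(s)`**, the supremum of the weighted open bubble `Φ_L(s) = Σ_w ‖w‖₂² τ₁(w) τ₁(w−s)` over the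
non-zero displacements (the product-form companion of `sup_{x≠0} H₁(x)`).
(GAPS G-D98: the off-diagonal addend `rawROffDiag` only — the diagonal `x = w` is the separate addend `rawRDiag`,
carried and priced on its own, and is not bounded here.)
[cite: FitznerVanDerHofstad2017, §5.2 (Hi-defs) and the display after (HD-def) (arXiv:1506.07977v2 p. 50); §4.2 (4.7), (4.14)–(4.17) (pp. 34–36)] -/
def wtOpenBubbleSup (L : Letters d) : ℝ≥0∞ := ⨆ s : Site d, ⨆ (_ : s ≠ 0), wtOpenBubbleAt L s

/-- `Φ_L(s) ≤ sup_{s≠0} Φ_L` for `s ≠ 0`.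
(GAPS G-D98: the off-diagonal addend `rawROffDiag` only — the diagonal `x = w` is the separate addend `rawRDiag`,
carried and priced on its own, and is not bounded here.)
[cite: FitznerVanDerHofstad2017, §5.2, display after (HD-def) (arXiv:1506.07977v2 p. 50)] -/
theorem wtOpenBubbleAt_le_wtOpenBubbleSup (L : Letters d) {s : Site d} (hs : s ≠ 0) :
    wtOpenBubbleAt L s ≤ wtOpenBubbleSup L :=
  le_iSup₂_of_le (f := fun (s : Site d) (_ : s ≠ 0) => wtOpenBubbleAt L s) s hs le_rfl

/-! ## B. Percolation: off the diagonal the third line has length `≥ 1` -/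

section Perc

variable (p : unitInterval)

/-- **A line between distinct points has length `≥ 1`**: `𝓣_{j₁,j₂,0}(x₁,x₂,x₃) = 𝓣_{j₁,j₂,1}(x₁,x₂,x₃)` for
`x₂ ≠ x₃` (`{x₂ ←0→ x₃} = {x₂ ↔ x₃} = {x₂ ←1→ x₃}`: every occupied path between distinct points has at least one
step).
(G-D98-neutral: a letter identity ∕ bound independent of the diagonal split.)
[cite: FitznerVanDerHofstad2017, §4.2 (4.1) and Def. 4.1 (4.17) (arXiv:1506.07977v2 pp. 34–36)] -/
theorem perc_T_geZero_eq_geOne_of_ne (j₁ j₂ : LenIdx) (x₁ : Site d) {x₂ x₃ : Site d} (h : x₂ ≠ x₃) :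
    (Letters.perc d p).T j₁ j₂ (.ge 0) x₁ x₂ x₃ = (Letters.perc d p).T j₁ j₂ (.ge 1) x₁ x₂ x₃ := by
  rw [perc_T, perc_T]
  have hE : lineEvents₃ j₁ j₂ (.ge 0) x₁ x₂ x₃ = lineEvents₃ j₁ j₂ (.ge 1) x₁ x₂ x₃ := by
    funext i
    fin_cases i
    · rfl
    · rfl
    · show (event (.ge 0) x₂ x₃ : Set (BondConfig (Site d))) = event (.ge 1) x₂ x₃
      rw [event_ge, event_ge, openConnGe_zero, openConnGe_one_eq h]
  rw [hE]

/-- **A repulsive triangle whose second line is a point-to-itself line of length `≥ 1` vanishes**: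
`𝓣_{j₁,j₂,j₃}(x₁,x₁,x₃) = 0` when the number of `j₂` is `≥ 1` (`{v ←j→ v} = ∅`).
(G-D98-neutral: a letter identity ∕ bound independent of the diagonal split.)
[cite: FitznerVanDerHofstad2017, §4.2 (4.1), (4.17) and Lemma 4.3 (4.31) (arXiv:1506.07977v2 pp. 34–38)] -/
theorem perc_T_self₂_eq_zero {j₂ : LenIdx} (hj : floor j₂ ≠ 0) (j₁ j₃ : LenIdx) (x₁ x₃ : Site d) :
    (Letters.perc d p).T j₁ j₂ j₃ x₁ x₁ x₃ = 0 := by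
  rw [perc_T]
  refine repLetter_eq_zero_of_null p _ 1 (isUpperSet_event j₂ x₁ x₁) ?_
  have h : (lineEvents₃ j₁ j₂ j₃ x₁ x₁ x₃ 1) = ∅ := by
    show (event j₂ x₁ x₁ : Set (BondConfig (Site d))) = ∅
    exact event_self_eq_empty hj x₁
  rw [h, measure_empty]

/-- **A repulsive triangle whose third line is a point-to-itself line of length `≥ 1` vanishes**:
`𝓣_{j₁,j₂,j₃}(x₁,x₂,x₂) = 0` when the number of `j₃` is `≥ 1`.
(G-D98-neutral: a letter identity ∕ bound independent of the diagonal split.)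
[cite: FitznerVanDerHofstad2017, §4.2 (4.1), (4.17) and Lemma 4.3 (4.31) (arXiv:1506.07977v2 pp. 34–38)] -/
theorem perc_T_self₃_eq_zero {j₃ : LenIdx} (hj : floor j₃ ≠ 0) (j₁ j₂ : LenIdx) (x₁ x₂ : Site d) :
    (Letters.perc d p).T j₁ j₂ j₃ x₁ x₂ x₂ = 0 := by
  rw [perc_T]
  refine repLetter_eq_zero_of_null p _ 2 (isUpperSet_event j₃ x₂ x₂) ?_
  have h : (lineEvents₃ j₁ j₂ j₃ x₁ x₂ x₂ 2) = ∅ := by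
    show (event j₃ x₂ x₂ : Set (BondConfig (Site d))) = ∅
    exact event_self_eq_empty hj x₂
  rw [h, measure_empty]

/-- Row `(2,0)` of `Ā'` at an exit `(u,w,t,z)` (every table): `δ_{t,z} 𝓣_{1̲,1,0}(e_ι, t−u, w−u)`. [folklore] -/
private theorem blockAbar'_two_zero_apply' (L : Letters d) (ι : Fin d × Bool) (u w t z : Site d) :
    blockAbar' L ι 2 0 u w t z = kd (t - u) (z - u) * L.T (.eq 1) (.ge 1) (.ge 0) (𝐞 ι) (t - u) (w - u) := by
  rw [blockAbar'_of_ne L ι (by decide)]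
  rfl

/-- Row `(1,0)` of `Ā'` at an exit `(u,w,t,z)` (every table):
`δ_{t,z} (1−δ_{t,u}) 2dD(w−u) 𝓣_{1̲,1,0}(e_ι, t−u, w−u)`. [folklore] -/
private theorem blockAbar'_one_zero_apply' (L : Letters d) (ι : Fin d × Bool) (u w t z : Site d) :
    blockAbar' L ι 1 0 u w t z =
      kd (t - u) (z - u) * kdc (t - u) 0 * twoDD (w - u) * L.T (.eq 1) (.ge 1) (.ge 0) (𝐞 ι) (t - u) (w - u) := by
  rw [blockAbar'_of_ne L ι (by decide)]
  rfl

/-- **Row `(2,0)` off the diagonal** (Case d)): `(1−δ_{x,w}) Ā'^{ι,2,0}(u,w,x,x) = (1−δ_{x,w}) 𝓣_{1̲,1,1}(e_ι, x−u, w−u)`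
— for `x ≠ w` the third line `{x ←0→ w}` is `{x ←1→ w}`; the point `x = w` (index `≥ 0`, the trivial line) is the
separate diagonal addend `rawRDiag` and is not touched.
(GAPS G-D98: the off-diagonal addend `rawROffDiag` only — the diagonal `x = w` is the separate addend `rawRDiag`,
carried and priced on its own, and is not bounded here.)
[cite: FitznerVanDerHofstad2017, App. C.1 Case d), the letter `T_{1̲,1,1}(e_ι,x−u,w−u)` of (C.5) — index pattern of the off-diagonal bound (arXiv:1506.07977v2 pp. 79–80); App. B Table "definition of A^{ι,a,b}", row a = 2, b = 0 (p. 75); §4.2 (4.1) (p. 34)] -/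
theorem perc_maskDiagR_blockAbar'_two_zero (ι : Fin d × Bool) (u w x : Site d) :
    maskDiagR (blockAbar' (Letters.perc d p)) ι 2 0 u w x x =
      kdc x w * (Letters.perc d p).T (.eq 1) (.ge 1) (.ge 1) (𝐞 ι) (x - u) (w - u) := by
  by_cases hx : x = w
  · subst hx
    simp only [maskDiagR, kdc_self, zero_mul]
  · simp only [maskDiagR, blockAbar'_two_zero_apply', kd_self, one_mul]
    rw [perc_T_geZero_eq_geOne_of_ne p _ _ _ (by rwa [Ne, sub_left_inj])]

/-- **Row `(1,0)` off the diagonal** (Case c)):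
`(1−δ_{x,w}) Ā'^{ι,1,0}(u,w,x,x) = (1−δ_{x,w}) (1−δ_{x,u}) 2dD(w−u) 𝓣_{1̲,1,1}(e_ι, x−u, w−u)`.
(GAPS G-D98: the off-diagonal addend `rawROffDiag` only — the diagonal `x = w` is the separate addend `rawRDiag`,
carried and priced on its own, and is not bounded here.)
[cite: FitznerVanDerHofstad2017, App. C.1 Case c), the letter `T_{1̲,1,1}` of (C.4) — index pattern of the off-diagonal bound (arXiv:1506.07977v2 p. 79); App. B Table "definition of A^{ι,a,b}", row a = 1, b = 0 (p. 75); §4.2 (4.1) (p. 34)] -/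
theorem perc_maskDiagR_blockAbar'_one_zero (ι : Fin d × Bool) (u w x : Site d) :
    maskDiagR (blockAbar' (Letters.perc d p)) ι 1 0 u w x x =
      kdc x w * (kdc (x - u) 0 * twoDD (w - u) * (Letters.perc d p).T (.eq 1) (.ge 1) (.ge 1) (𝐞 ι) (x - u) (w - u)) := by
  by_cases hx : x = w
  · subst hx
    simp only [maskDiagR, kdc_self, zero_mul]
  · simp only [maskDiagR, blockAbar'_one_zero_apply', kd_self, one_mul]
    rw [perc_T_geZero_eq_geOne_of_ne p _ _ _ (by rwa [Ne, sub_left_inj])]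

/-! ## C. Percolation: the weighted off-diagonal middle letter is the second member of `H₂` -/

/-- `e_{opp ι} = −e_ι`. [folklore] -/
private theorem stepVec_opp' (ι : Fin d × Bool) : (𝐞 (opp ι) : Site d) = -𝐞 ι := by
  obtain ⟨i, b⟩ := ι
  cases b <;> simp [Percolation.stepVec, opp]

/-- **Transport of the off-diagonal middle letter**: `𝓣_{1̲,1,1}(e_ι, x−u, w−u)` (base point `u`: lines
`{u ←1̲→ u+e_ι}, {u+e_ι ←1→ x}, {x ←1→ w}`) `= 𝓣_{1,1,1̲}(x−w, (u−w)+e_ι, u−w)` (base point `w`: lines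
`{w ←1→ x}, {x ←1→ u+e_ι}, {u+e_ι ←1̲→ u}`): translation invariance, lines relabelled in reverse order and read
backwards (no line changes its index).
(GAPS G-D98: the off-diagonal addend `rawROffDiag` only — the diagonal `x = w` is the separate addend `rawRDiag`,
carried and priced on its own, and is not bounded here.)
[cite: FitznerVanDerHofstad2017, §4.2 Def. 4.1, (4.16)–(4.17) (arXiv:1506.07977v2 pp. 35–36); §3.5 (p. 32); App. C.1 (C.4)–(C.5) — index pattern of the off-diagonal bound (pp. 79–80)] -/
theorem perc_T_offMid_transport (u w x : Site d) (ι : Fin d × Bool) :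
    (Letters.perc d p).T (.eq 1) (.ge 1) (.ge 1) (𝐞 ι) (x - u) (w - u) =
      (Letters.perc d p).T (.ge 1) (.ge 1) (.eq 1) (x - w) (u - w + 𝐞 ι) (u - w) := by
  rw [perc_T, perc_T]
  have h1 : lineEvents₃ (.eq 1) (.ge 1) (.ge 1) (𝐞 ι) (x - u) (w - u) =
      fun i => event ((![.eq 1, .ge 1, .ge 1] : Fin 3 → LenIdx) i) ((![0, 𝐞 ι, x - u] : Fin 3 → Site d) i)
        ((![𝐞 ι, x - u, w - u] : Fin 3 → Site d) i) := by
    funext i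
    fin_cases i <;> rfl
  have h2 : (fun i => event ((![.eq 1, .ge 1, .ge 1] : Fin 3 → LenIdx) i)
        ((![0, 𝐞 ι, x - u] : Fin 3 → Site d) i + u) ((![𝐞 ι, x - u, w - u] : Fin 3 → Site d) i + u)) =
      (fun i => event ((![.ge 1, .ge 1, .eq 1] : Fin 3 → LenIdx) i)
        ((![0, x - w, u - w + 𝐞 ι] : Fin 3 → Site d) i + w) ((![x - w, u - w + 𝐞 ι, u - w] : Fin 3 → Site d) i + w)) ∘
        ⇑(Fin.revPerm : Equiv.Perm (Fin 3)) := by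
    funext i
    fin_cases i
    · show (event (.eq 1) (0 + u) (𝐞 ι + u) : Set (BondConfig (Site d))) =
          event (.eq 1) (u - w + 𝐞 ι + w) (u - w + w)
      rw [event_comm, zero_add, sub_add_cancel, add_comm (𝐞 ι) u]
      congr 1
      abel
    · show (event (.ge 1) (𝐞 ι + u) (x - u + u) : Set (BondConfig (Site d))) =
          event (.ge 1) (x - w + w) (u - w + 𝐞 ι + w)
      rw [event_comm, sub_add_cancel, sub_add_cancel, add_comm (𝐞 ι) u]
      congr 1
      abel
    · show (event (.ge 1) (x - u + u) (w - u + u) : Set (BondConfig (Site d))) =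
          event (.ge 1) (0 + w) (x - w + w)
      rw [event_comm, sub_add_cancel, sub_add_cancel, zero_add, sub_add_cancel]
  have h3 : (fun i => event ((![.ge 1, .ge 1, .eq 1] : Fin 3 → LenIdx) i)
        ((![0, x - w, u - w + 𝐞 ι] : Fin 3 → Site d) i) ((![x - w, u - w + 𝐞 ι, u - w] : Fin 3 → Site d) i)) =
      lineEvents₃ (.ge 1) (.ge 1) (.eq 1) (x - w) (u - w + 𝐞 ι) (u - w) := by
    funext i
    fin_cases i <;> rfl
  rw [h1, ← repLetter_event_shift p u, h2, repLetter_comp_perm, repLetter_event_shift p w, h3]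

/-- **The `‖x−w‖₂²`-weighted off-diagonal middle letter, summed, is the second member of `H₂(u−w)`**:
`Σ_ι Σ_x ‖w−x‖₂² (1−δ_{x,w}) 𝓣_{1̲,1,1}(e_ι,x−u,w−u) = Σ_{e,y} ‖y‖₂² 𝓣_{1,1,1̲}(y,(u−w)−e,u−w)` (`y = x − w`,
`e = −e_ι`; the point `x = w` carries weight `0`).
(GAPS G-D98: the off-diagonal addend `rawROffDiag` only — the diagonal `x = w` is the separate addend `rawRDiag`,
carried and priced on its own, and is not bounded here.)
[cite: FitznerVanDerHofstad2017, §5.2 (Hi-defs), second member, n = 2 (arXiv:1506.07977v2 p. 50); App. C.1 (C.5), the factor `H₂` — index pattern of the off-diagonal bound (p. 80)] -/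
theorem perc_sum_tsum_wt_offMid_eq_letterHT₁ (u w : Site d) :
    ∑ ι, ∑' x, wt (w - x) * (kdc x w * (Letters.perc d p).T (.eq 1) (.ge 1) (.ge 1) (𝐞 ι) (x - u) (w - u)) =
      letterHT₁ (Letters.perc d p) 2 (u - w) := by
  have h : ∀ ι : Fin d × Bool,
      ∑' y, wt y * (Letters.perc d p).T (.ge 1) (.ge 1) (.eq 1) y (u - w + 𝐞 ι) (u - w) =
        ∑' x, wt (w - x) * (kdc x w * (Letters.perc d p).T (.eq 1) (.ge 1) (.ge 1) (𝐞 ι) (x - u) (w - u)) := by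
    intro ι
    rw [← (Equiv.subRight w).tsum_eq]
    refine tsum_congr fun x => ?_
    simp only [Equiv.subRight_apply]
    by_cases hx : x = w
    · subst hx
      simp only [sub_self, wt_zero, zero_mul]
    · rw [kdc_of_ne hx, one_mul, wt_sub_comm w x, perc_T_offMid_transport]
  simp_rw [← h]
  unfold letterHT₁
  refine Fintype.sum_equiv (Function.Involutive.toPerm opp opp_opp) _ _ fun ι => ?_
  simp only [Function.Involutive.coe_toPerm, stepVec_opp', sub_neg_eq_add]

/-- **The plain off-diagonal middle sum at base point `u`**:
`Σ_ι Σ_x (1−δ_{x,w}) 𝓣_{1̲,1,1}(e_ι,x−u,w−u) = M(w−u)` (translation by `u`; the point `x = w` contributes `0` on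
both sides: the third line would be a point-to-itself line of length `≥ 1`).
(GAPS G-D98: the off-diagonal addend `rawROffDiag` only — the diagonal `x = w` is the separate addend `rawRDiag`,
carried and priced on its own, and is not bounded here.)
[cite: FitznerVanDerHofstad2017, App. C.1 (C.4)–(C.5) — index pattern of the off-diagonal bound (arXiv:1506.07977v2 pp. 79–80); §4.2 (4.17) (p. 36)] -/
theorem perc_sum_tsum_offMid_eq_offMidSum (u w : Site d) :
    ∑ ι, ∑' x, kdc x w * (Letters.perc d p).T (.eq 1) (.ge 1) (.ge 1) (𝐞 ι) (x - u) (w - u) =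
      offMidSum (Letters.perc d p) (w - u) := by
  unfold offMidSum
  refine Finset.sum_congr rfl fun ι _ => ?_
  rw [← (Equiv.addRight u).tsum_eq]
  refine tsum_congr fun x => ?_
  simp only [Equiv.coe_addRight, add_sub_cancel_right]
  by_cases hx : x = w - u
  · subst hx
    rw [perc_T_self₃_eq_zero p (j₃ := .ge 1) one_ne_zero, mul_zero]
  · rw [kdc_of_ne (fun h => hx (eq_sub_of_add_eq h)), one_mul]

/-! ## D. Class `a = 2` (Case d)): the off-diagonal right piece `Σ_ι rawROffDiag (P^{S,2}) (Ā'^{ι,2,0})` -/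

/-- Class-`2` off-diagonal integrand with the weight on `‖x−w‖₂²` (every point): start letter and masked middle row
factorised.
(GAPS G-D98: the off-diagonal addend `rawROffDiag` only — the diagonal `x = w` is the separate addend `rawRDiag`,
carried and priced on its own, and is not bounded here.)
[cite: FitznerVanDerHofstad2017, App. C.1 Case d) — index pattern of the off-diagonal bound (arXiv:1506.07977v2 pp. 79–80); App. B Tables `P^b` row b ≥ 2, `A^{ι,a,b}` row (2,0) (pp. 73–75)] -/
theorem perc_offDiagR_two_integrand_X (ι : Fin d × Bool) (x u w : Site d) :
    wt (w - x) * (kdc w 0 * (blockPSn (Letters.perc d p) 2 u w * maskDiagR (blockAbar' (Letters.perc d p)) ι 2 0 u w x x)) =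
      (kdc u 0 * kdc w 0 * (Letters.perc d p).T (.ge 1) (.ge 2) (.ge 1) u w 0) *
        (wt (w - x) * (kdc x w * (Letters.perc d p).T (.eq 1) (.ge 1) (.ge 1) (𝐞 ι) (x - u) (w - u))) := by
  rw [perc_maskDiagR_blockAbar'_two_zero]
  have h := kdc_mul_blockPSn_two (Letters.perc d p) u w
  calc wt (w - x) * (kdc w 0 * (blockPSn (Letters.perc d p) 2 u w *
          (kdc x w * (Letters.perc d p).T (.eq 1) (.ge 1) (.ge 1) (𝐞 ι) (x - u) (w - u))))
      = wt (w - x) * ((kdc w 0 * blockPSn (Letters.perc d p) 2 u w) *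
          (kdc x w * (Letters.perc d p).T (.eq 1) (.ge 1) (.ge 1) (𝐞 ι) (x - u) (w - u))) := by ring
    _ = _ := by rw [h]; ring

/-- Class-`2` off-diagonal integrand with the weight on `‖w‖₂²` (every point).
(GAPS G-D98: the off-diagonal addend `rawROffDiag` only — the diagonal `x = w` is the separate addend `rawRDiag`,
carried and priced on its own, and is not bounded here.)
[cite: FitznerVanDerHofstad2017, App. C.1 Case d) — index pattern of the off-diagonal bound (arXiv:1506.07977v2 pp. 79–80); App. B Tables `P^b` row b ≥ 2, `A^{ι,a,b}` row (2,0) (pp. 73–75)] -/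
theorem perc_offDiagR_two_integrand_W (ι : Fin d × Bool) (x u w : Site d) :
    wt w * (kdc w 0 * (blockPSn (Letters.perc d p) 2 u w * maskDiagR (blockAbar' (Letters.perc d p)) ι 2 0 u w x x)) =
      (wt w * (kdc w 0 * (kdc u 0 * (Letters.perc d p).T (.ge 1) (.ge 2) (.ge 1) u w 0))) *
        (kdc x w * (Letters.perc d p).T (.eq 1) (.ge 1) (.ge 1) (𝐞 ι) (x - u) (w - u)) := by
  rw [perc_maskDiagR_blockAbar'_two_zero]
  have h := kdc_mul_blockPSn_two (Letters.perc d p) u w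
  calc wt w * (kdc w 0 * (blockPSn (Letters.perc d p) 2 u w *
          (kdc x w * (Letters.perc d p).T (.eq 1) (.ge 1) (.ge 1) (𝐞 ι) (x - u) (w - u))))
      = wt w * ((kdc w 0 * blockPSn (Letters.perc d p) 2 u w) *
          (kdc x w * (Letters.perc d p).T (.eq 1) (.ge 1) (.ge 1) (𝐞 ι) (x - u) (w - u))) := by ring
    _ = _ := by rw [h]; ring

/-- **Case d), the `‖x−w‖₂²` term, as an identity**:
`Σ_ι Σ_{x,u,w} ‖w−x‖₂² (1−δ_{w,0}) P^{S,2}(u,w) (1−δ_{x,w}) Ā'^{ι,2,0}(u,w,x,x)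
 = Σ_{u,w} (1−δ_{u,0})(1−δ_{w,0}) 𝓣_{1,2,1}(u,w,0) · Σ_{e,y} ‖y‖₂² 𝓣_{1,1,1̲}(y,(u−w)−e,u−w)`
(the weighted middle is the second member of `H₂(u−w)`).
(GAPS G-D98: the off-diagonal addend `rawROffDiag` only — the diagonal `x = w` is the separate addend `rawRDiag`,
carried and priced on its own, and is not bounded here.)
[cite: FitznerVanDerHofstad2017, App. C.1 Case d), (C.5) second term — index pattern of the off-diagonal bound (arXiv:1506.07977v2 p. 80); §5.2 (Hi-defs) (p. 50)] -/
theorem perc_offDiagR_two_termX_eq :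
    ∑ ι, ∑' x, ∑' u, ∑' w, wt (w - x) *
        (kdc w 0 * (blockPSn (Letters.perc d p) 2 u w * maskDiagR (blockAbar' (Letters.perc d p)) ι 2 0 u w x x)) =
      ∑' u, ∑' w, (kdc u 0 * kdc w 0 * (Letters.perc d p).T (.ge 1) (.ge 2) (.ge 1) u w 0) *
        letterHT₁ (Letters.perc d p) 2 (u - w) := by
  simp_rw [perc_offDiagR_two_integrand_X]
  refine (sum_tsum₃_factor (fun u w => kdc u 0 * kdc w 0 * (Letters.perc d p).T (.ge 1) (.ge 2) (.ge 1) u w 0)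
    (fun ι x u w => wt (w - x) * (kdc x w * (Letters.perc d p).T (.eq 1) (.ge 1) (.ge 1) (𝐞 ι) (x - u) (w - u)))).trans ?_
  refine tsum_congr fun u => tsum_congr fun w => ?_
  rw [perc_sum_tsum_wt_offMid_eq_letterHT₁]

/-- **Case d), the `‖x−w‖₂²` term, bounded by `sup_{x≠0} H₂(x)`** — the second term of (C.5):
`… ≤ sup_{s≠0} H₂(s) · Σ_{u,w} (1−δ_{u,0})(1−δ_{w,0}) 𝓣_{1,2,1}(u,w,0)` (the member `u = w` vanishes: its start
letter has the point-to-itself middle line `{w ←2→ w}`).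
(GAPS G-D98: the off-diagonal addend `rawROffDiag` only — the diagonal `x = w` is the separate addend `rawRDiag`,
carried and priced on its own, and is not bounded here.)
[cite: FitznerVanDerHofstad2017, App. C.1 (C.5), second term `2 sup_{x≠0} H₂(x) Σ_{x,y} T_{1,2,1}(x,y,0)` — index pattern of the off-diagonal bound (arXiv:1506.07977v2 p. 80); §5.2 (Hi-defs) (p. 50)] -/
theorem perc_offDiagR_two_termX_le :
    ∑ ι, ∑' x, ∑' u, ∑' w, wt (w - x) *
        (kdc w 0 * (blockPSn (Letters.perc d p) 2 u w * maskDiagR (blockAbar' (Letters.perc d p)) ι 2 0 u w x x)) ≤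
      letterHsup (Letters.perc d p) 2 *
        ∑' u, ∑' w, kdc u 0 * kdc w 0 * (Letters.perc d p).T (.ge 1) (.ge 2) (.ge 1) u w 0 := by
  rw [perc_offDiagR_two_termX_eq, ← ENNReal.tsum_mul_left]
  refine ENNReal.tsum_le_tsum fun u => ?_
  rw [← ENNReal.tsum_mul_left]
  refine ENNReal.tsum_le_tsum fun w => ?_
  by_cases huw : u = w
  · subst huw
    rw [perc_T_self₂_eq_zero p (j₂ := .ge 2) two_ne_zero, mul_zero, mul_zero, zero_mul]
  · rw [mul_comm (letterHsup _ _)]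
    gcongr
    exact (letterHT₁_le_letterH _ 2 _).trans (letterH_le_letterHsup _ 2 (sub_ne_zero.mpr huw))

/-- **Case d), the `‖w‖₂²` term, factorised** (every point of the start kept as the letter `𝓣_{1,2,1}`):
`Σ_ι Σ_{x,u,w} ‖w‖₂² (…) = Σ_{u,w} ‖w‖₂² (1−δ_{w,0})(1−δ_{u,0}) 𝓣_{1,2,1}(u,w,0) · M(w−u)`.
(GAPS G-D98: the off-diagonal addend `rawROffDiag` only — the diagonal `x = w` is the separate addend `rawRDiag`,
carried and priced on its own, and is not bounded here.)
[cite: FitznerVanDerHofstad2017, App. C.1 Case d), (C.5) first term — index pattern of the off-diagonal bound (arXiv:1506.07977v2 p. 80); Lemma 5.1 second version (p. 50)] -/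
theorem perc_offDiagR_two_termW_eq :
    ∑ ι, ∑' x, ∑' u, ∑' w, wt w *
        (kdc w 0 * (blockPSn (Letters.perc d p) 2 u w * maskDiagR (blockAbar' (Letters.perc d p)) ι 2 0 u w x x)) =
      ∑' u, ∑' w, (wt w * (kdc w 0 * (kdc u 0 * (Letters.perc d p).T (.ge 1) (.ge 2) (.ge 1) u w 0))) *
        offMidSum (Letters.perc d p) (w - u) := by
  simp_rw [perc_offDiagR_two_integrand_W]
  refine (sum_tsum₃_factor (fun u w => wt w * (kdc w 0 * (kdc u 0 * (Letters.perc d p).T (.ge 1) (.ge 2) (.ge 1) u w 0)))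
    (fun ι x u w => kdc x w * (Letters.perc d p).T (.eq 1) (.ge 1) (.ge 1) (𝐞 ι) (x - u) (w - u))).trans ?_
  refine tsum_congr fun u => tsum_congr fun w => ?_
  rw [perc_sum_tsum_offMid_eq_offMidSum]

/-- **Case d), the `‖w‖₂²` term, with the start letter kept** (an identity): substituting `s := w − u`,
`Σ_ι Σ_{x,u,w} ‖w‖₂² (…) = Σ_s M(s) · WTT(s)`, `WTT(s) = Σ_w ‖w‖₂² (1−δ_{w,0})(1−δ_{w−s,0}) 𝓣_{1,2,1}(w−s,w,0)`
(`NobleWeightedDiagRight.diagWTT`).  Print's first term of (C.5), `2 sup_x H₁(x) Σ 𝓢_{1̲,1,1,2}`, REGROUPS the start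
line `{u ←2→ w}` into the middle letter; those regrouped letters are not reached by the typed objects, and (C.5) is
cited only as the source of the index pattern of the off-diagonal bound.
(GAPS G-D98: the off-diagonal addend `rawROffDiag` only — the diagonal `x = w` is the separate addend `rawRDiag`,
carried and priced on its own, and is not bounded here.)
[cite: FitznerVanDerHofstad2017, App. C.1 Case d), (C.5) first term — index pattern of the off-diagonal bound (arXiv:1506.07977v2 p. 80); Lemma 5.1 second version (p. 50); App. B "Building blocks with weight" (p. 78)] -/
theorem perc_offDiagR_two_termW_eq_diagWTT :
    ∑ ι, ∑' x, ∑' u, ∑' w, wt w *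
        (kdc w 0 * (blockPSn (Letters.perc d p) 2 u w * maskDiagR (blockAbar' (Letters.perc d p)) ι 2 0 u w x x)) =
      ∑' s, offMidSum (Letters.perc d p) s * diagWTT (Letters.perc d p) s := by
  rw [perc_offDiagR_two_termW_eq, ENNReal.tsum_comm]
  have h : ∀ w : Site d,
      ∑' u, (wt w * (kdc w 0 * (kdc u 0 * (Letters.perc d p).T (.ge 1) (.ge 2) (.ge 1) u w 0))) *
          offMidSum (Letters.perc d p) (w - u) =
        ∑' s, (wt w * (kdc w 0 * (kdc (w - s) 0 * (Letters.perc d p).T (.ge 1) (.ge 2) (.ge 1) (w - s) w 0))) *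
          offMidSum (Letters.perc d p) s := by
    intro w
    rw [← (Equiv.subLeft w).tsum_eq]
    simp only [Equiv.subLeft_apply, sub_sub_cancel]
  simp_rw [h]
  rw [ENNReal.tsum_comm]
  refine tsum_congr fun s => ?_
  rw [diagWTT, ← ENNReal.tsum_mul_left]
  refine tsum_congr fun w => ?_
  ring

/-- **Case d), the `‖w‖₂²` term, product-bounded** (corollary, `WTT(s) ≤ τ₂(s)·Φ(s)`):
`… ≤ Σ_s τ₂(s) · M(s) · Φ(s)`, `Φ(s) = Σ_w ‖w‖₂² τ₁(w) τ₁(w−s)`.  Print's `2 sup_x H₁(x) Σ 𝓢_{1̲,1,1,2}` of (C.5) is a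
REGROUPED letter the typed product does not reach; (C.5) is cited only as the source of the index pattern of the
off-diagonal bound.
(GAPS G-D98: the off-diagonal addend `rawROffDiag` only — the diagonal `x = w` is the separate addend `rawRDiag`,
carried and priced on its own, and is not bounded here.)
[cite: FitznerVanDerHofstad2017, App. C.1 Case d), (C.5) first term — index pattern of the off-diagonal bound (arXiv:1506.07977v2 p. 80); §4.2 (4.8), (4.14)–(4.17) (pp. 34–36); §3.5 (p. 32)] -/
theorem perc_offDiagR_two_termW_le :
    ∑ ι, ∑' x, ∑' u, ∑' w, wt w *
        (kdc w 0 * (blockPSn (Letters.perc d p) 2 u w * maskDiagR (blockAbar' (Letters.perc d p)) ι 2 0 u w x x)) ≤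
      ∑' s, (Letters.perc d p).tau (.ge 2) s * offMidSum (Letters.perc d p) s * wtOpenBubbleAt (Letters.perc d p) s := by
  rw [perc_offDiagR_two_termW_eq_diagWTT]
  refine ENNReal.tsum_le_tsum fun s => ?_
  calc offMidSum (Letters.perc d p) s * diagWTT (Letters.perc d p) s
      ≤ offMidSum (Letters.perc d p) s * ((Letters.perc d p).tau (.ge 2) s * wtOpenBubbleAt (Letters.perc d p) s) :=
        mul_le_mul' le_rfl (perc_diagWTT_le p s)
    _ = _ := by ring

/-- **Case d) — the off-diagonal right piece of class `2`, bounded with the start letters kept**: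
`Σ_ι rawROffDiag (P^{S,2}) (Ā'^{ι,2,0}) ≤ 2·Σ_s M(s)·WTT(s) + 2·Σ_{u,w} (1−δ_{u,0})(1−δ_{w,0}) 𝓣_{1,2,1}(u,w,0)·(H₂-member)(u−w)`
(only the norm split `‖x‖₂² ≤ 2‖w‖₂² + 2‖x−w‖₂²` is an inequality; both terms are then identities).
(GAPS G-D98: the off-diagonal addend `rawROffDiag` only — the diagonal `x = w` is the separate addend `rawRDiag`,
carried and priced on its own, and is not bounded here.)
[cite: FitznerVanDerHofstad2017, App. C.1 Case d), (C.5) — index pattern of the off-diagonal bound (arXiv:1506.07977v2 pp. 79–80); §5.2 (Hi-defs) (p. 50); Lemma 5.1 second version (p. 50)] -/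
theorem perc_sum_rawROffDiag_two_le_letters :
    ∑ ι, rawROffDiag (blockPSn (Letters.perc d p)) (blockAbar' (Letters.perc d p)) ι 2 ≤
      2 * (∑' s, offMidSum (Letters.perc d p) s * diagWTT (Letters.perc d p) s) +
        2 * (∑' u, ∑' w, (kdc u 0 * kdc w 0 * (Letters.perc d p).T (.ge 1) (.ge 2) (.ge 1) u w 0) *
          letterHT₁ (Letters.perc d p) 2 (u - w)) := by
  simp_rw [rawROffDiag_eq_rawRPieceOff0_maskDiagR]
  calc ∑ ι, rawRPieceOff0 (blockPSn (Letters.perc d p)) (maskDiagR (blockAbar' (Letters.perc d p))) ι 2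
      ≤ ∑ ι, (2 * (∑' x, ∑' u, ∑' w, wt w * (kdc w 0 * (blockPSn (Letters.perc d p) 2 u w *
            maskDiagR (blockAbar' (Letters.perc d p)) ι 2 0 u w x x))) +
          2 * (∑' x, ∑' u, ∑' w, wt (w - x) * (kdc w 0 * (blockPSn (Letters.perc d p) 2 u w *
            maskDiagR (blockAbar' (Letters.perc d p)) ι 2 0 u w x x)))) :=
        Finset.sum_le_sum fun ι _ => rawRPieceOff0_le_two_split _ _ ι 2
    _ = 2 * (∑ ι, ∑' x, ∑' u, ∑' w, wt w * (kdc w 0 * (blockPSn (Letters.perc d p) 2 u w *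
            maskDiagR (blockAbar' (Letters.perc d p)) ι 2 0 u w x x))) +
          2 * (∑ ι, ∑' x, ∑' u, ∑' w, wt (w - x) * (kdc w 0 * (blockPSn (Letters.perc d p) 2 u w *
            maskDiagR (blockAbar' (Letters.perc d p)) ι 2 0 u w x x))) := by
        rw [Finset.sum_add_distrib, Finset.mul_sum, Finset.mul_sum]
    _ = _ := by rw [perc_offDiagR_two_termW_eq_diagWTT, perc_offDiagR_two_termX_eq]

/-- **Case d) — the off-diagonal right piece of class `2`, product-bounded** (corollary):
`Σ_ι rawROffDiag (P^{S,2}) (Ā'^{ι,2,0}) ≤ 2·Σ_s τ₂(s) M(s) Φ(s) + 2·Σ_{u,w} (1−δ_{u,0})(1−δ_{w,0}) 𝓣_{1,2,1}(u,w,0)·(H₂-member)(u−w)`.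
Print's `2 sup_x H₁(x) Σ 𝓢_{1̲,1,1,2}` of (C.5) is a REGROUPED letter the typed product does not reach.
(GAPS G-D98: the off-diagonal addend `rawROffDiag` only — the diagonal `x = w` is the separate addend `rawRDiag`,
carried and priced on its own, and is not bounded here.)
[cite: FitznerVanDerHofstad2017, App. C.1 Case d), (C.5) — index pattern of the off-diagonal bound (arXiv:1506.07977v2 pp. 79–80); §5.2 (Hi-defs) (p. 50); §4.2 (4.8), (4.14)–(4.17) (pp. 34–36)] -/
theorem perc_sum_rawROffDiag_two_le :
    ∑ ι, rawROffDiag (blockPSn (Letters.perc d p)) (blockAbar' (Letters.perc d p)) ι 2 ≤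
      2 * (∑' s, (Letters.perc d p).tau (.ge 2) s * offMidSum (Letters.perc d p) s * wtOpenBubbleAt (Letters.perc d p) s) +
        2 * (∑' u, ∑' w, (kdc u 0 * kdc w 0 * (Letters.perc d p).T (.ge 1) (.ge 2) (.ge 1) u w 0) *
          letterHT₁ (Letters.perc d p) 2 (u - w)) := by
  refine (perc_sum_rawROffDiag_two_le_letters p).trans (add_le_add (mul_le_mul' le_rfl ?_) le_rfl)
  rw [← perc_offDiagR_two_termW_eq_diagWTT]
  exact perc_offDiagR_two_termW_le p

/-- **Case d) with the suprema extracted** (the shape of (C.5)):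
`Σ_ι rawROffDiag (P^{S,2}) (Ā'^{ι,2,0}) ≤ 2·(sup_{s≠0} Φ(s))·Σ_s τ₂(s) M(s) + 2·(sup_{s≠0} H₂(s))·Σ_{u,w} 𝓣_{1,2,1}(u,w,0)`
(the members `s = 0`, `u = w` vanish: `{0 ←2→ 0} = {w ←2→ w} = ∅`).  Print's `sup H₁ · Σ 𝓢_{1̲,1,1,2}` is a
REGROUPED letter the typed product does not reach; the second term is print's `2 sup_{x≠0} H₂(x) Σ T_{1,2,1}`.
(GAPS G-D98: the off-diagonal addend `rawROffDiag` only — the diagonal `x = w` is the separate addend `rawRDiag`,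
carried and priced on its own, and is not bounded here.)
[cite: FitznerVanDerHofstad2017, App. C.1 (C.5) — index pattern of the off-diagonal bound (arXiv:1506.07977v2 p. 80); §5.2 (Hi-defs), display after (HD-def) (p. 50)] -/
theorem perc_sum_rawROffDiag_two_le_sup :
    ∑ ι, rawROffDiag (blockPSn (Letters.perc d p)) (blockAbar' (Letters.perc d p)) ι 2 ≤
      2 * (wtOpenBubbleSup (Letters.perc d p) *
          ∑' s, (Letters.perc d p).tau (.ge 2) s * offMidSum (Letters.perc d p) s) +
        2 * (letterHsup (Letters.perc d p) 2 *
          ∑' u, ∑' w, kdc u 0 * kdc w 0 * (Letters.perc d p).T (.ge 1) (.ge 2) (.ge 1) u w 0) := by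
  refine (perc_sum_rawROffDiag_two_le p).trans ?_
  gcongr
  · rw [← ENNReal.tsum_mul_left]
    refine ENNReal.tsum_le_tsum fun s => ?_
    by_cases hs : s = 0
    · subst hs
      have h0 : (Letters.perc d p).tau (.ge 2) (0 : Site d) = 0 := by
        rw [perc_tau, event_ge, openConnGe_self_eq_empty (by decide) (0 : Site d), measure_empty]
      rw [h0, zero_mul, zero_mul, mul_zero]
    · rw [mul_comm (wtOpenBubbleSup _)]
      gcongr
      exact wtOpenBubbleAt_le_wtOpenBubbleSup _ hs
  · rw [← ENNReal.tsum_mul_left]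
    refine ENNReal.tsum_le_tsum fun u => ?_
    rw [← ENNReal.tsum_mul_left]
    refine ENNReal.tsum_le_tsum fun w => ?_
    by_cases huw : u = w
    · subst huw
      rw [perc_T_self₂_eq_zero p (j₂ := .ge 2) two_ne_zero, mul_zero, mul_zero, zero_mul]
    · rw [mul_comm (letterHsup _ _)]
      gcongr
      exact (letterHT₁_le_letterH _ 2 _).trans (letterH_le_letterHsup _ 2 (sub_ne_zero.mpr huw))

/-! ## E. Class `a = 1` (Case c)): the off-diagonal right piece `Σ_ι rawROffDiag (P^{S,1}) (Ā'^{ι,1,0})` -/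

/-- `σ w − σ y = σ (w − y)` (additivity of the signed coordinate permutations). [folklore] -/
private theorem signedPerm_sub_signedPerm' (π : Equiv.Perm (Fin d)) (ε : Fin d → ℤˣ) (w y : Site d) :
    Site.signedPerm π ε w - Site.signedPerm π ε y = Site.signedPerm π ε (w - y) := by
  have h := zdSignedPermIso_sub π ε w y
  simp only [zdSignedPermIso_apply] at h
  exact h.symm

/-- **The second member of `H_n` is `W_d`-invariant**: `Σ_{e,y} ‖y‖₂² 𝓣_{1,n−1,1̲}(y, σs−e, σs) = Σ_{e,y} ‖y‖₂² 𝓣_{1,n−1,1̲}(y, s−e, s)`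
(reindex `y` and `e` along `σ ∈ W_d`).
(G-D98-neutral: a letter identity ∕ bound independent of the diagonal split.)
[cite: FitznerVanDerHofstad2017, §3.5 "Symmetry of the model" (arXiv:1506.07977v2 p. 32); §5.2 (Hi-defs) (p. 50); §4.2 (4.17) (p. 36)] -/
theorem signedPermInvariant_perc_letterHT₁ (n : ℕ) :
    SignedPermInvariant (letterHT₁ (Letters.perc d p) n : Site d → ℝ≥0∞) := by
  intro π ε s
  unfold letterHT₁
  calc ∑ ι : Fin d × Bool, ∑' y, wt y * (Letters.perc d p).T (.ge 1) (.ge (n - 1)) (.eq 1) y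
          (Site.signedPerm π ε s - 𝐞 ι) (Site.signedPerm π ε s)
      = ∑ ι : Fin d × Bool, ∑' y, wt y * (Letters.perc d p).T (.ge 1) (.ge (n - 1)) (.eq 1) y
          (Site.signedPerm π ε s - Site.signedPerm π ε (𝐞 ι)) (Site.signedPerm π ε s) :=
        (sum_stepVec_signedPerm π ε fun e => ∑' y, wt y * (Letters.perc d p).T (.ge 1) (.ge (n - 1)) (.eq 1) y
          (Site.signedPerm π ε s - e) (Site.signedPerm π ε s)).symm
    _ = ∑ ι : Fin d × Bool, ∑' y, wt y * (Letters.perc d p).T (.ge 1) (.ge (n - 1)) (.eq 1) y (s - 𝐞 ι) s :=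
        Finset.sum_congr rfl fun ι _ => by
          calc ∑' y, wt y * (Letters.perc d p).T (.ge 1) (.ge (n - 1)) (.eq 1) y
                  (Site.signedPerm π ε s - Site.signedPerm π ε (𝐞 ι)) (Site.signedPerm π ε s)
              = ∑' y, wt (Site.signedPerm π ε y) * (Letters.perc d p).T (.ge 1) (.ge (n - 1)) (.eq 1)
                  (Site.signedPerm π ε y) (Site.signedPerm π ε s - Site.signedPerm π ε (𝐞 ι)) (Site.signedPerm π ε s) :=
                (tsum_signedPerm π ε _).symm
            _ = _ := tsum_congr fun y => by rw [signedPerm_sub_signedPerm', wt_signedPerm, perc_T_signedPerm]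

/-- **The plain off-diagonal middle sum is `W_d`-invariant**: `M(σs) = M(s)`.
(GAPS G-D98: the off-diagonal addend `rawROffDiag` only — the diagonal `x = w` is the separate addend `rawRDiag`,
carried and priced on its own, and is not bounded here.)
[cite: FitznerVanDerHofstad2017, §3.5 "Symmetry of the model" (arXiv:1506.07977v2 p. 32); §4.2 (4.17) (p. 36)] -/
theorem signedPermInvariant_perc_offMidSum :
    SignedPermInvariant (offMidSum (Letters.perc d p) : Site d → ℝ≥0∞) := by
  intro π ε s
  unfold offMidSum
  calc ∑ ι : Fin d × Bool, ∑' x, (Letters.perc d p).T (.eq 1) (.ge 1) (.ge 1) (𝐞 ι) x (Site.signedPerm π ε s)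
      = ∑ ι : Fin d × Bool, ∑' x, (Letters.perc d p).T (.eq 1) (.ge 1) (.ge 1) (Site.signedPerm π ε (𝐞 ι)) x
          (Site.signedPerm π ε s) :=
        (sum_stepVec_signedPerm π ε fun e => ∑' x, (Letters.perc d p).T (.eq 1) (.ge 1) (.ge 1) e x
          (Site.signedPerm π ε s)).symm
    _ = ∑ ι : Fin d × Bool, ∑' x, (Letters.perc d p).T (.eq 1) (.ge 1) (.ge 1) (𝐞 ι) x s :=
        Finset.sum_congr rfl fun ι _ => by
          calc ∑' x, (Letters.perc d p).T (.eq 1) (.ge 1) (.ge 1) (Site.signedPerm π ε (𝐞 ι)) x (Site.signedPerm π ε s)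
              = ∑' x, (Letters.perc d p).T (.eq 1) (.ge 1) (.ge 1) (Site.signedPerm π ε (𝐞 ι)) (Site.signedPerm π ε x)
                  (Site.signedPerm π ε s) := (tsum_signedPerm π ε _).symm
            _ = _ := tsum_congr fun x => by rw [perc_T_signedPerm]

/-- **The plain open bubble `Φ⁰(s) = Σ_w τ₁(w) τ₁(w−s)` (`openBubbleAt` of `NobleWeightedDiagLeft`) is
`W_d`-invariant.**
(G-D98-neutral: a letter identity ∕ bound independent of the diagonal split.)
[cite: FitznerVanDerHofstad2017, §3.5 "Symmetry of the model" (arXiv:1506.07977v2 p. 32); §4.2 (4.1) (p. 34)] -/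
theorem signedPermInvariant_perc_openBubbleAt :
    SignedPermInvariant (openBubbleAt (Letters.perc d p) : Site d → ℝ≥0∞) := by
  intro π ε s
  unfold openBubbleAt
  calc ∑' w, (Letters.perc d p).tau (.ge 1) w * (Letters.perc d p).tau (.ge 1) (w - Site.signedPerm π ε s)
      = ∑' w, (Letters.perc d p).tau (.ge 1) (Site.signedPerm π ε w)
          * (Letters.perc d p).tau (.ge 1) (Site.signedPerm π ε w - Site.signedPerm π ε s) := (tsum_signedPerm π ε _).symm
    _ = ∑' w, (Letters.perc d p).tau (.ge 1) w * (Letters.perc d p).tau (.ge 1) (w - s) :=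
        tsum_congr fun w => by rw [perc_tau_signedPerm, perc_tau_signedPerm_sub]

/-- **The plain start letter summed off `0`, `TT_j(s) = Σ_w (1−δ_{w,0})(1−δ_{w−s,0}) 𝓣_{1,j,1}(w−s,w,0)`
(`diagLTT` of `NobleWeightedDiagLeft` — the same letter sum serves there as the left exit triangle), is
`W_d`-invariant in `s`** (every middle index `j`; reindex `w` along `σ`, `σ0 = 0`).
(G-D98-neutral: a letter identity independent of the diagonal split.)
[cite: FitznerVanDerHofstad2017, §3.5 "Symmetry of the model" (arXiv:1506.07977v2 p. 32); §4.2 (4.17) (p. 36); App. B Table "definition of P^b(x,y)" (p. 73)] -/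
theorem signedPermInvariant_perc_diagLTT (j : LenIdx) :
    SignedPermInvariant (diagLTT (Letters.perc d p) j : Site d → ℝ≥0∞) := by
  intro π ε s
  unfold diagLTT diagLIntegrand
  calc ∑' w, kdc w 0 * (kdc (w - Site.signedPerm π ε s) 0 *
          (Letters.perc d p).T (.ge 1) j (.ge 1) (w - Site.signedPerm π ε s) w 0)
      = ∑' w, kdc (Site.signedPerm π ε w) 0 * (kdc (Site.signedPerm π ε w - Site.signedPerm π ε s) 0 *
          (Letters.perc d p).T (.ge 1) j (.ge 1) (Site.signedPerm π ε w - Site.signedPerm π ε s)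
            (Site.signedPerm π ε w) 0) := (tsum_signedPerm π ε _).symm
    _ = ∑' w, kdc w 0 * (kdc (w - s) 0 * (Letters.perc d p).T (.ge 1) j (.ge 1) (w - s) w 0) :=
        tsum_congr fun w => by
          have hT : (Letters.perc d p).T (.ge 1) j (.ge 1) (Site.signedPerm π ε (w - s))
              (Site.signedPerm π ε w) 0 = (Letters.perc d p).T (.ge 1) j (.ge 1) (w - s) w 0 := by
            simpa only [Site.signedPerm_zero] using perc_T_signedPerm p π ε (.ge 1) j (.ge 1) (w - s) w 0
          rw [signedPerm_sub_signedPerm', kdc_signedPerm_zero, kdc_signedPerm_zero, hT]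

/-- Class-`1` off-diagonal integrand with the weight on `‖x−w‖₂²` (every point): start letter
`(1−δ_{u,0}) 𝓣_{1,1̲,1}(u,w,0)` and masked middle row `(1,0)` factorised.
(GAPS G-D98: the off-diagonal addend `rawROffDiag` only — the diagonal `x = w` is the separate addend `rawRDiag`,
carried and priced on its own, and is not bounded here.)
[cite: FitznerVanDerHofstad2017, App. C.1 Case c) — index pattern of the off-diagonal bound (arXiv:1506.07977v2 p. 79); App. B Tables `P^b` row b = 1, `A^{ι,a,b}` row (1,0) (pp. 73–75)] -/
theorem perc_offDiagR_one_integrand_X (ι : Fin d × Bool) (x u w : Site d) :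
    wt (w - x) * (kdc w 0 * (blockPSn (Letters.perc d p) 1 u w * maskDiagR (blockAbar' (Letters.perc d p)) ι 1 0 u w x x)) =
      (kdc u 0 * kdc w 0 * (Letters.perc d p).T (.ge 1) (.eq 1) (.ge 1) u w 0 * twoDD (w - u)) *
        (wt (w - x) * (kdc x w * (kdc (x - u) 0 *
          (Letters.perc d p).T (.eq 1) (.ge 1) (.ge 1) (𝐞 ι) (x - u) (w - u)))) := by
  rw [perc_maskDiagR_blockAbar'_one_zero]
  have h := kdc_mul_blockPSn_one (Letters.perc d p) u w
  calc wt (w - x) * (kdc w 0 * (blockPSn (Letters.perc d p) 1 u w * (kdc x w * (kdc (x - u) 0 * twoDD (w - u) *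
          (Letters.perc d p).T (.eq 1) (.ge 1) (.ge 1) (𝐞 ι) (x - u) (w - u)))))
      = wt (w - x) * ((kdc w 0 * blockPSn (Letters.perc d p) 1 u w) * (kdc x w * (kdc (x - u) 0 * twoDD (w - u) *
          (Letters.perc d p).T (.eq 1) (.ge 1) (.ge 1) (𝐞 ι) (x - u) (w - u)))) := by ring
    _ = _ := by rw [h]; ring

/-- Class-`1` off-diagonal integrand with the weight on `‖w‖₂²` (every point).
(GAPS G-D98: the off-diagonal addend `rawROffDiag` only — the diagonal `x = w` is the separate addend `rawRDiag`,
carried and priced on its own, and is not bounded here.)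
[cite: FitznerVanDerHofstad2017, App. C.1 Case c) — index pattern of the off-diagonal bound (arXiv:1506.07977v2 p. 79); App. B Tables `P^b` row b = 1, `A^{ι,a,b}` row (1,0) (pp. 73–75)] -/
theorem perc_offDiagR_one_integrand_W (ι : Fin d × Bool) (x u w : Site d) :
    wt w * (kdc w 0 * (blockPSn (Letters.perc d p) 1 u w * maskDiagR (blockAbar' (Letters.perc d p)) ι 1 0 u w x x)) =
      (wt w * (kdc w 0 * (kdc u 0 * (Letters.perc d p).T (.ge 1) (.eq 1) (.ge 1) u w 0)) * twoDD (w - u)) *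
        (kdc x w * (kdc (x - u) 0 * (Letters.perc d p).T (.eq 1) (.ge 1) (.ge 1) (𝐞 ι) (x - u) (w - u))) := by
  rw [perc_maskDiagR_blockAbar'_one_zero]
  have h := kdc_mul_blockPSn_one (Letters.perc d p) u w
  calc wt w * (kdc w 0 * (blockPSn (Letters.perc d p) 1 u w * (kdc x w * (kdc (x - u) 0 * twoDD (w - u) *
          (Letters.perc d p).T (.eq 1) (.ge 1) (.ge 1) (𝐞 ι) (x - u) (w - u)))))
      = wt w * ((kdc w 0 * blockPSn (Letters.perc d p) 1 u w) * (kdc x w * (kdc (x - u) 0 * twoDD (w - u) *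
          (Letters.perc d p).T (.eq 1) (.ge 1) (.ge 1) (𝐞 ι) (x - u) (w - u)))) := by ring
    _ = _ := by rw [h]; ring

/-- The class-`1` weighted middle (with its extra `(1−δ_{x,u})`) is below the second member of `H₂(u−w)`.
(GAPS G-D98: the off-diagonal addend `rawROffDiag` only — the diagonal `x = w` is the separate addend `rawRDiag`,
carried and priced on its own, and is not bounded here.)
[cite: FitznerVanDerHofstad2017, App. C.1 Case c), the factor `H₂(e₁)` of (C.4) — index pattern of the off-diagonal bound (arXiv:1506.07977v2 p. 79); §5.2 (Hi-defs) (p. 50)] -/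
theorem perc_sum_tsum_wt_offMid₁_le_letterHT₁ (u w : Site d) :
    ∑ ι, ∑' x, wt (w - x) * (kdc x w * (kdc (x - u) 0 *
        (Letters.perc d p).T (.eq 1) (.ge 1) (.ge 1) (𝐞 ι) (x - u) (w - u))) ≤
      letterHT₁ (Letters.perc d p) 2 (u - w) := by
  rw [← perc_sum_tsum_wt_offMid_eq_letterHT₁ p u w]
  exact Finset.sum_le_sum fun ι _ => ENNReal.tsum_le_tsum fun x =>
    mul_le_mul' le_rfl (mul_le_mul' le_rfl ((mul_le_mul' (kdc_le_one _ _) le_rfl).trans_eq (one_mul _)))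

/-- The class-`1` plain middle (with its extra `(1−δ_{x,u})`) is below `M(w−u)`.
(GAPS G-D98: the off-diagonal addend `rawROffDiag` only — the diagonal `x = w` is the separate addend `rawRDiag`,
carried and priced on its own, and is not bounded here.)
[cite: FitznerVanDerHofstad2017, App. C.1 Case c), the sum `Σ_{ι,x} T_{1,1,1̲}` of (C.4) — index pattern of the off-diagonal bound (arXiv:1506.07977v2 p. 79); §4.2 (4.17) (p. 36)] -/
theorem perc_sum_tsum_offMid₁_le_offMidSum (u w : Site d) :
    ∑ ι, ∑' x, kdc x w * (kdc (x - u) 0 * (Letters.perc d p).T (.eq 1) (.ge 1) (.ge 1) (𝐞 ι) (x - u) (w - u)) ≤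
      offMidSum (Letters.perc d p) (w - u) := by
  rw [← perc_sum_tsum_offMid_eq_offMidSum p u w]
  exact Finset.sum_le_sum fun ι _ => ENNReal.tsum_le_tsum fun x =>
    mul_le_mul' le_rfl ((mul_le_mul' (kdc_le_one _ _) le_rfl).trans_eq (one_mul _))

/-- **Case c), the `‖x−w‖₂²` term, with the start letter kept**: the middle displacement `w − u` runs over the
`2d` unit vectors (`2dD(w−u)`), the weighted middle is the `H₂`-member at `u − w = −e_κ`, equal for all directions
(`W_d`), and so is the plain start sum `Σ_w (1−δ_{w,0})(1−δ_{w−e_κ,0}) 𝓣_{1,1̲,1}(w−e_κ,w,0)`: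
`… ≤ (H₂-member)(e_{ι₀}) · 2d · TT_{1̲}(e_{ι₀})`, `TT_{1̲}(s) = Σ_w (1−δ_{w,0})(1−δ_{w−s,0}) 𝓣_{1,1̲,1}(w−s,w,0)` (`diagLTT 𝐋 1̲ s`)
— the second term of (C.4), `4dp H₂(e₁) Σ_x B_{1,1}(x,e₁)`, with the repulsive start letter kept (the only inequality is
`(1−δ_{x,u}) ≤ 1` in the middle); (C.4) is cited only as the source of the index pattern of the off-diagonal bound.
(GAPS G-D98: the off-diagonal addend `rawROffDiag` only — the diagonal `x = w` is the separate addend `rawRDiag`,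
carried and priced on its own, and is not bounded here.)
[cite: FitznerVanDerHofstad2017, App. C.1 Case c), (C.4) second term — index pattern of the off-diagonal bound (arXiv:1506.07977v2 p. 79); §5.2 (Hi-defs) (p. 50); §3.5 (p. 32); App. B Tables `P^b` row b = 1 (p. 73)] -/
theorem perc_offDiagR_one_termX_le_letter (ι₀ : Fin d × Bool) :
    ∑ ι, ∑' x, ∑' u, ∑' w, wt (w - x) *
        (kdc w 0 * (blockPSn (Letters.perc d p) 1 u w * maskDiagR (blockAbar' (Letters.perc d p)) ι 1 0 u w x x)) ≤
      letterHT₁ (Letters.perc d p) 2 (𝐞 ι₀) * ((2 * d : ℝ≥0∞) * diagLTT (Letters.perc d p) (.eq 1) (𝐞 ι₀)) := by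
  simp_rw [perc_offDiagR_one_integrand_X]
  refine (sum_tsum₃_factor
    (fun u w => kdc u 0 * kdc w 0 * (Letters.perc d p).T (.ge 1) (.eq 1) (.ge 1) u w 0 * twoDD (w - u))
    (fun ι x u w => wt (w - x) * (kdc x w * (kdc (x - u) 0 *
      (Letters.perc d p).T (.eq 1) (.ge 1) (.ge 1) (𝐞 ι) (x - u) (w - u))))).trans_le ?_
  calc ∑' u, ∑' w, (kdc u 0 * kdc w 0 * (Letters.perc d p).T (.ge 1) (.eq 1) (.ge 1) u w 0 * twoDD (w - u)) *
          ∑ ι, ∑' x, wt (w - x) * (kdc x w * (kdc (x - u) 0 *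
            (Letters.perc d p).T (.eq 1) (.ge 1) (.ge 1) (𝐞 ι) (x - u) (w - u)))
      ≤ ∑' u, ∑' w, (kdc u 0 * kdc w 0 * (Letters.perc d p).T (.ge 1) (.eq 1) (.ge 1) u w 0 * twoDD (w - u)) *
          letterHT₁ (Letters.perc d p) 2 (u - w) :=
        ENNReal.tsum_le_tsum fun u => ENNReal.tsum_le_tsum fun w =>
          mul_le_mul' le_rfl (perc_sum_tsum_wt_offMid₁_le_letterHT₁ p u w)
    _ = ∑' w, ∑ κ : Fin d × Bool, (kdc (w - 𝐞 κ) 0 * kdc w 0 *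
          (Letters.perc d p).T (.ge 1) (.eq 1) (.ge 1) (w - 𝐞 κ) w 0) * letterHT₁ (Letters.perc d p) 2 (𝐞 ι₀) := by
        rw [ENNReal.tsum_comm]
        refine tsum_congr fun w => ?_
        rw [← (Equiv.subLeft w).tsum_eq]
        simp only [Equiv.subLeft_apply, sub_sub_cancel, sub_sub_cancel_left]
        rw [tsum_eq_sum_stepVec_of_eq_zero (F := fun s : Site d =>
          (kdc (w - s) 0 * kdc w 0 * (Letters.perc d p).T (.ge 1) (.eq 1) (.ge 1) (w - s) w 0 * twoDD s) *
            letterHT₁ (Letters.perc d p) 2 (-s)) fun s hs => by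
              simp only [twoDD_of_not_mem_unitVecs hs, mul_zero, zero_mul]]
        refine Finset.sum_congr rfl fun κ _ => ?_
        rw [twoDD_stepVec, mul_one, ← stepVec_opp', (signedPermInvariant_perc_letterHT₁ p 2).apply_stepVec_eq (opp κ) ι₀]
    _ = letterHT₁ (Letters.perc d p) 2 (𝐞 ι₀) * ∑ κ : Fin d × Bool, ∑' w, kdc w 0 * (kdc (w - 𝐞 κ) 0 *
          (Letters.perc d p).T (.ge 1) (.eq 1) (.ge 1) (w - 𝐞 κ) w 0) := by
        rw [← tsum_finsetSum, ← ENNReal.tsum_mul_left]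
        refine tsum_congr fun w => ?_
        rw [Finset.mul_sum]
        refine Finset.sum_congr rfl fun κ _ => ?_
        ring
    _ = letterHT₁ (Letters.perc d p) 2 (𝐞 ι₀) * ∑ κ : Fin d × Bool, diagLTT (Letters.perc d p) (.eq 1) (𝐞 κ) := rfl
    _ = _ := by
        rw [(signedPermInvariant_perc_diagLTT p (.eq 1)).sum_stepVec_eq ι₀, nsmul_eq_mul]
        push_cast
        rfl

/-- **Case c), the `‖x−w‖₂²` term, product-bounded** (corollary: `TT_{1̲}(e) ≤ τ_{1̲}(e)·Φ⁰(e)`, `perc_diagLTT_le`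
of `NobleWeightedDiagLeft`, and `τ_{1̲}(e) = p`): `… ≤ (H₂-member)(e_{ι₀}) · 2d · p · Φ⁰(e_{ι₀})`, `Φ⁰(y) = Σ_w τ₁(w) τ₁(w−y)`
the plain open bubble (`openBubbleAt`).  Print's `4dp H₂(e₁) Σ_x B_{1,1}(x,e₁)` of (C.4); (C.4) is cited only as the
source of the index pattern of the off-diagonal bound.
(GAPS G-D98: the off-diagonal addend `rawROffDiag` only — the diagonal `x = w` is the separate addend `rawRDiag`,
carried and priced on its own, and is not bounded here.)
[cite: FitznerVanDerHofstad2017, App. C.1 Case c), (C.4) second term — index pattern of the off-diagonal bound (arXiv:1506.07977v2 p. 79); §5.2 (Hi-defs) (p. 50); §4.2 (4.7)–(4.8), (4.14)–(4.17) (pp. 34–36); §3.5 (p. 32)] -/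
theorem perc_offDiagR_one_termX_le (ι₀ : Fin d × Bool) :
    ∑ ι, ∑' x, ∑' u, ∑' w, wt (w - x) *
        (kdc w 0 * (blockPSn (Letters.perc d p) 1 u w * maskDiagR (blockAbar' (Letters.perc d p)) ι 1 0 u w x x)) ≤
      letterHT₁ (Letters.perc d p) 2 (𝐞 ι₀) * ((2 * d : ℝ≥0∞) * (ENNReal.ofReal p *
        openBubbleAt (Letters.perc d p) (𝐞 ι₀))) := by
  refine (perc_offDiagR_one_termX_le_letter p ι₀).trans (mul_le_mul' le_rfl (mul_le_mul' le_rfl ?_))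
  refine (perc_diagLTT_le p (.eq 1) (𝐞 ι₀)).trans_eq ?_
  rw [perc_tau_eq_one_stepVec]

/-- **Case c), the `‖w‖₂²` term, with the start letter kept**: the middle displacement runs over the unit vectors,
the plain middle is `M(e_κ)`, equal for all directions, and the weighted start is `WTB(e_κ)`
(`NobleWeightedDiagRight.diagWTB`, `W_d`-invariant): `… ≤ 2d · M(e_{ι₀}) · WTB(e_{ι₀})` — the first term of (C.4),
`4dp H₁(e₁) Σ_{ι,x} T_{1,1,1̲}(x,e₁+e_ι,e₁)`, with the start letter kept (the only inequality is `(1−δ_{x,u}) ≤ 1` in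
the middle).  Print's `H₁(e₁)` there is a REGROUPED reading (the weighted repulsive bubble); (C.4) is cited only as
the source of the index pattern of the off-diagonal bound.
(GAPS G-D98: the off-diagonal addend `rawROffDiag` only — the diagonal `x = w` is the separate addend `rawRDiag`,
carried and priced on its own, and is not bounded here.)
[cite: FitznerVanDerHofstad2017, App. C.1 Case c), (C.4) first term — index pattern of the off-diagonal bound (arXiv:1506.07977v2 p. 79); Lemma 5.1 second version (p. 50); App. B "Building blocks with weight" (p. 78); §3.5 (p. 32)] -/
theorem perc_offDiagR_one_termW_le_diagWTB (ι₀ : Fin d × Bool) :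
    ∑ ι, ∑' x, ∑' u, ∑' w, wt w *
        (kdc w 0 * (blockPSn (Letters.perc d p) 1 u w * maskDiagR (blockAbar' (Letters.perc d p)) ι 1 0 u w x x)) ≤
      (2 * d : ℝ≥0∞) * (offMidSum (Letters.perc d p) (𝐞 ι₀) * diagWTB (Letters.perc d p) (𝐞 ι₀)) := by
  simp_rw [perc_offDiagR_one_integrand_W]
  refine (sum_tsum₃_factor
    (fun u w => wt w * (kdc w 0 * (kdc u 0 * (Letters.perc d p).T (.ge 1) (.eq 1) (.ge 1) u w 0)) * twoDD (w - u))
    (fun ι x u w => kdc x w * (kdc (x - u) 0 *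
      (Letters.perc d p).T (.eq 1) (.ge 1) (.ge 1) (𝐞 ι) (x - u) (w - u)))).trans_le ?_
  calc ∑' u, ∑' w, (wt w * (kdc w 0 * (kdc u 0 * (Letters.perc d p).T (.ge 1) (.eq 1) (.ge 1) u w 0)) * twoDD (w - u)) *
          ∑ ι, ∑' x, kdc x w * (kdc (x - u) 0 * (Letters.perc d p).T (.eq 1) (.ge 1) (.ge 1) (𝐞 ι) (x - u) (w - u))
      ≤ ∑' u, ∑' w, (wt w * (kdc w 0 * (kdc u 0 * (Letters.perc d p).T (.ge 1) (.eq 1) (.ge 1) u w 0)) * twoDD (w - u)) *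
          offMidSum (Letters.perc d p) (w - u) :=
        ENNReal.tsum_le_tsum fun u => ENNReal.tsum_le_tsum fun w =>
          mul_le_mul' le_rfl (perc_sum_tsum_offMid₁_le_offMidSum p u w)
    _ = ∑' w, ∑ κ : Fin d × Bool, (wt w * (kdc w 0 * (kdc (w - 𝐞 κ) 0 *
          (Letters.perc d p).T (.ge 1) (.eq 1) (.ge 1) (w - 𝐞 κ) w 0))) * offMidSum (Letters.perc d p) (𝐞 κ) := by
        rw [ENNReal.tsum_comm]
        refine tsum_congr fun w => ?_
        rw [← (Equiv.subLeft w).tsum_eq]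
        simp only [Equiv.subLeft_apply, sub_sub_cancel]
        rw [tsum_eq_sum_stepVec_of_eq_zero (F := fun s : Site d =>
          (wt w * (kdc w 0 * (kdc (w - s) 0 * (Letters.perc d p).T (.ge 1) (.eq 1) (.ge 1) (w - s) w 0)) * twoDD s) *
            offMidSum (Letters.perc d p) s) fun s hs => by
              simp only [twoDD_of_not_mem_unitVecs hs, mul_zero, zero_mul]]
        refine Finset.sum_congr rfl fun κ _ => ?_
        rw [twoDD_stepVec, mul_one]
    _ = ∑ κ : Fin d × Bool, offMidSum (Letters.perc d p) (𝐞 κ) * diagWTB (Letters.perc d p) (𝐞 κ) := by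
        rw [tsum_finsetSum]
        refine Finset.sum_congr rfl fun κ _ => ?_
        rw [diagWTB, ← ENNReal.tsum_mul_left]
        refine tsum_congr fun w => ?_
        ring
    _ = (2 * d : ℝ≥0∞) * (offMidSum (Letters.perc d p) (𝐞 ι₀) * diagWTB (Letters.perc d p) (𝐞 ι₀)) := by
        rw [((signedPermInvariant_perc_offMidSum p).mul (signedPermInvariant_perc_diagWTB p)).sum_stepVec_eq ι₀,
          nsmul_eq_mul]
        push_cast
        rfl

/-- **Case c), the `‖w‖₂²` term, product-bounded** (corollary, `WTB(e_κ) ≤ p·Φ(e_κ)`):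
`… ≤ 2d · M(e_{ι₀}) · p · Φ(e_{ι₀})`.  Print's `4dp H₁(e₁) Σ_{ι,x} T_{1,1,1̲}(x,e₁+e_ι,e₁)` of (C.4) is a REGROUPED
letter the typed product does not reach; (C.4) is cited only as the source of the index pattern of the off-diagonal
bound.
(GAPS G-D98: the off-diagonal addend `rawROffDiag` only — the diagonal `x = w` is the separate addend `rawRDiag`,
carried and priced on its own, and is not bounded here.)
[cite: FitznerVanDerHofstad2017, App. C.1 Case c), (C.4) first term — index pattern of the off-diagonal bound (arXiv:1506.07977v2 p. 79); §4.2 (4.8), (4.14)–(4.17) (pp. 34–36); §3.5 (p. 32)] -/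
theorem perc_offDiagR_one_termW_le (ι₀ : Fin d × Bool) :
    ∑ ι, ∑' x, ∑' u, ∑' w, wt w *
        (kdc w 0 * (blockPSn (Letters.perc d p) 1 u w * maskDiagR (blockAbar' (Letters.perc d p)) ι 1 0 u w x x)) ≤
      (2 * d : ℝ≥0∞) * (offMidSum (Letters.perc d p) (𝐞 ι₀) *
        (ENNReal.ofReal p * wtOpenBubbleAt (Letters.perc d p) (𝐞 ι₀))) :=
  (perc_offDiagR_one_termW_le_diagWTB p ι₀).trans
    (mul_le_mul' le_rfl (mul_le_mul' le_rfl (perc_diagWTB_stepVec_le p ι₀)))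

/-- **Case c) — the off-diagonal right piece of class `1`, bounded with the start letters kept**:
`Σ_ι rawROffDiag (P^{S,1}) (Ā'^{ι,1,0}) ≤ 2·2d·M(e_{ι₀})·WTB(e_{ι₀}) + 2·(H₂-member)(e_{ι₀})·2d·TT_{1̲}(e_{ι₀})`
for every direction `ι₀`, `TT_{1̲} = diagLTT 𝐋 1̲` the plain start letter summed off `0` (print: the two terms of (C.4);
the start letters are kept, the middle loses only `(1−δ_{x,u}) ≤ 1`).
(GAPS G-D98: the off-diagonal addend `rawROffDiag` only — the diagonal `x = w` is the separate addend `rawRDiag`,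
carried and priced on its own, and is not bounded here.)
[cite: FitznerVanDerHofstad2017, App. C.1 Case c), (C.4) — index pattern of the off-diagonal bound (arXiv:1506.07977v2 p. 79); §5.2 (Hi-defs) (p. 50); Lemma 5.1 second version (p. 50)] -/
theorem perc_sum_rawROffDiag_one_le_letters (ι₀ : Fin d × Bool) :
    ∑ ι, rawROffDiag (blockPSn (Letters.perc d p)) (blockAbar' (Letters.perc d p)) ι 1 ≤
      2 * ((2 * d : ℝ≥0∞) * (offMidSum (Letters.perc d p) (𝐞 ι₀) * diagWTB (Letters.perc d p) (𝐞 ι₀))) +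
        2 * (letterHT₁ (Letters.perc d p) 2 (𝐞 ι₀) * ((2 * d : ℝ≥0∞) *
          diagLTT (Letters.perc d p) (.eq 1) (𝐞 ι₀))) := by
  simp_rw [rawROffDiag_eq_rawRPieceOff0_maskDiagR]
  calc ∑ ι, rawRPieceOff0 (blockPSn (Letters.perc d p)) (maskDiagR (blockAbar' (Letters.perc d p))) ι 1
      ≤ ∑ ι, (2 * (∑' x, ∑' u, ∑' w, wt w * (kdc w 0 * (blockPSn (Letters.perc d p) 1 u w *
            maskDiagR (blockAbar' (Letters.perc d p)) ι 1 0 u w x x))) +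
          2 * (∑' x, ∑' u, ∑' w, wt (w - x) * (kdc w 0 * (blockPSn (Letters.perc d p) 1 u w *
            maskDiagR (blockAbar' (Letters.perc d p)) ι 1 0 u w x x)))) :=
        Finset.sum_le_sum fun ι _ => rawRPieceOff0_le_two_split _ _ ι 1
    _ = 2 * (∑ ι, ∑' x, ∑' u, ∑' w, wt w * (kdc w 0 * (blockPSn (Letters.perc d p) 1 u w *
            maskDiagR (blockAbar' (Letters.perc d p)) ι 1 0 u w x x))) +
          2 * (∑ ι, ∑' x, ∑' u, ∑' w, wt (w - x) * (kdc w 0 * (blockPSn (Letters.perc d p) 1 u w *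
            maskDiagR (blockAbar' (Letters.perc d p)) ι 1 0 u w x x))) := by
        rw [Finset.sum_add_distrib, Finset.mul_sum, Finset.mul_sum]
    _ ≤ _ := add_le_add (mul_le_mul' le_rfl (perc_offDiagR_one_termW_le_diagWTB p ι₀))
        (mul_le_mul' le_rfl (perc_offDiagR_one_termX_le_letter p ι₀))

/-- **Case c) — the off-diagonal right piece of class `1`, product-bounded** (corollary):
`Σ_ι rawROffDiag (P^{S,1}) (Ā'^{ι,1,0}) ≤ 2·2d·M(e_{ι₀})·p·Φ(e_{ι₀}) + 2·(H₂-member)(e_{ι₀})·2d·p·Φ⁰(e_{ι₀})`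
(`Φ = wtOpenBubbleAt`, `Φ⁰ = openBubbleAt`; print: `4dp H₁(e₁) Σ_{ι,x} T_{1,1,1̲}(x,e₁+e_ι,e₁) + 4dp H₂(e₁) Σ_x B_{1,1}(x,e₁)`, (C.4), whose `H₁(e₁)`-reading is a
REGROUPED letter the typed product does not reach; the typed start bubbles are in product form).
(GAPS G-D98: the off-diagonal addend `rawROffDiag` only — the diagonal `x = w` is the separate addend `rawRDiag`,
carried and priced on its own, and is not bounded here.)
[cite: FitznerVanDerHofstad2017, App. C.1 Case c), (C.4) — index pattern of the off-diagonal bound (arXiv:1506.07977v2 p. 79); §5.2 (Hi-defs) (p. 50); §4.2 (4.8), (4.14)–(4.17) (pp. 34–36)] -/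
theorem perc_sum_rawROffDiag_one_le (ι₀ : Fin d × Bool) :
    ∑ ι, rawROffDiag (blockPSn (Letters.perc d p)) (blockAbar' (Letters.perc d p)) ι 1 ≤
      2 * ((2 * d : ℝ≥0∞) * (offMidSum (Letters.perc d p) (𝐞 ι₀) *
          (ENNReal.ofReal p * wtOpenBubbleAt (Letters.perc d p) (𝐞 ι₀)))) +
        2 * (letterHT₁ (Letters.perc d p) 2 (𝐞 ι₀) * ((2 * d : ℝ≥0∞) * (ENNReal.ofReal p *
          openBubbleAt (Letters.perc d p) (𝐞 ι₀)))) := by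
  refine (perc_sum_rawROffDiag_one_le_letters p ι₀).trans (add_le_add (mul_le_mul' le_rfl ?_) (mul_le_mul' le_rfl ?_))
  · exact mul_le_mul' le_rfl (mul_le_mul' le_rfl (perc_diagWTB_stepVec_le p ι₀))
  · refine mul_le_mul' le_rfl (mul_le_mul' le_rfl ?_)
    refine (perc_diagLTT_le p (.eq 1) (𝐞 ι₀)).trans_eq ?_
    rw [perc_tau_eq_one_stepVec]

end Perc

end Literature.Probability.FitznerVanDerHofstad2017

end
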